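import Literature.Probability.RandomPlanarGeometry.ObservableShortTime
import Literature.Probability.RandomPlanarGeometry.SLEKappaRhoSchrammObservable
import Literature.Probability.RandomPlanarGeometry.LoewnerCotArgExit
import HarnessLib

/-!
# Reading the Loewner flow of a point off a prescribed hull; the deterministic time cap

Topic `Literature/Probability/RandomPlanarGeometry`; theorems only (namespace `Loewner`). Two
elementary facts used when a LATTICE past (a half-plane hull `K` with its hydrodynamic map
`g_K` and tip value `ξ`) is read in the coordinates of the Loewner chain of a continuous driving
function `W` that has grown exactly `K` at time `u` (`hull W u = K ∩ ℍ`, `g_u = g_K` off `K`):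

* `mem_diff_of_four_mul_lt`, `map_eq_of_hull_eq`, `deriv_map_eq_of_hull_eq`,
  `derivRatio_eq_of_hull_eq`, `centredMap_eq_of_hull_eq`, `schrammObs_eq_of_hull_eq` — a point
  `z` with `4u < (Im z)²` is not swallowed (`lt_swallowingTime_of_four_mul_lt`, CDHKS (2014) §3:
  "`Im g_t(w) ≥ 2√t` as long as `Im w ≥ 3√t`"), so `g_u(z) = g_K(z)`, `g_u'(z) = g_K'(z)` (the
  maps agree on the open Loewner domain `H_u = ℍ ∖ K`, Lawler (2005) §4.1), and Rohde–Schramm's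
  ratio `ψ_u(z) = Im z |g_u'(z)|/Im g_u(z)` and Schramm's observable `S_u(z)` are the
  corresponding HULL functionals of `(K, ξ = W_u)`;
* `le_sInf_roomLevel_of_sixteen_mul_le` — **the deterministic time cap**: for `m ≥ 1` and
  `16u ≤ (Im z)²` (and `u ≤ m + 1`), the level-`m` room stop
  `inf ({s | Im z_s ≤ Im z/(m+1)} ∪ {m+1})` has not occurred by time `u`, for EVERY continuous
  driving function: `(Im g_s(z))² ≥ (Im z)² - 4s > (Im z)²/4` for `s < u` (Lawler (2005), proof
  of Thm. 4.6; this is the rôle of CDHKS's time `T(iy) = y²/9` for the Ising observable).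

No definitions, no named facts.

## References

* G. F. Lawler, *Conformally Invariant Processes in the Plane*, AMS (2005), Ch. 4 §4.1
  (Thm. 4.6 and its proof; Prop. 4.4).
* D. Chelkak, H. Duminil-Copin, C. Hongler, A. Kemppainen, S. Smirnov, C. R. Math. Acad. Sci.
  Paris 352 (2014) 157–161, §3.
* S. Rohde, O. Schramm, Ann. of Math. 161 (2005), Lemma 6.3.
-/

noncomputable section

open Set Filter Topology Complex
open scoped NNReal
open UpperHalfPlane (upperHalfPlaneSet)

namespace Literature.Probability.RandomPlanarGeometry

namespace Loewner

variable {W : ℝ≥0 → ℝ} {z : ℂ}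

/-! ### A point above height `2√u` read off a prescribed hull -/

/-- If `4u < (Im z)²` and the Loewner hull at time `u` is `K ∩ ℍ`, then `z ∈ ℍ ∖ K` (the point has
not been swallowed: `lt_swallowingTime_of_four_mul_lt`). [cite: CDHKSCRAS2014, §3] -/
theorem mem_diff_of_four_mul_lt (hW : Continuous W) (hz : 0 < z.im) {u : ℝ≥0}
    (hu : 4 * (u : ℝ) < z.im ^ 2) {K : Set ℂ} (hhull : hull W u = K ∩ upperHalfPlaneSet) :
    z ∈ upperHalfPlaneSet \ K := by
  have hdom : z ∈ domain W u :=
    (mem_domain_iff W u z).2 ⟨hz, lt_swallowingTime_of_four_mul_lt hW hz hu⟩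
  refine ⟨hz, fun hzK ↦ hdom.2 ?_⟩
  rw [hhull]
  exact ⟨hzK, hz⟩

/-- The Loewner domain at time `u` lies in `ℍ ∖ K` when the hull at time `u` is `K ∩ ℍ`.
[cite: Lawler2005, Ch. 4 §4.1] -/
theorem domain_subset_diff_of_hull_eq {u : ℝ≥0} {K : Set ℂ}
    (hhull : hull W u = K ∩ upperHalfPlaneSet) : domain W u ⊆ upperHalfPlaneSet \ K := by
  intro x hx
  refine ⟨hx.1, fun hxK ↦ hx.2 ?_⟩
  rw [hhull]
  exact ⟨hxK, hx.1⟩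

/-- **`g_u(z) = g_K(z)`**: if the hull at time `u` is `K ∩ ℍ`, the Loewner map agrees with `g` off
`K`, and `4u < (Im z)²`, then `map W u z = g z`. [cite: Lawler2005, Ch. 4 §4.1 Prop. 4.4] -/
theorem map_eq_of_hull_eq (hW : Continuous W) (hz : 0 < z.im) {u : ℝ≥0}
    (hu : 4 * (u : ℝ) < z.im ^ 2) {K : Set ℂ} {g : ℂ → ℂ}
    (hhull : hull W u = K ∩ upperHalfPlaneSet) (hmap : EqOn (map W u) g (upperHalfPlaneSet \ K)) :
    map W u z = g z :=
  hmap (mem_diff_of_four_mul_lt hW hz hu hhull)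

/-- **`g_u'(z) = g_K'(z)`**: the two maps agree on the open Loewner domain `H_u ∋ z`
(`isOpen_domain`), hence have the same derivative at `z`. [cite: Lawler2005, Ch. 4 §4.1 Prop. 4.4] -/
theorem deriv_map_eq_of_hull_eq (hW : Continuous W) (hz : 0 < z.im) {u : ℝ≥0}
    (hu : 4 * (u : ℝ) < z.im ^ 2) {K : Set ℂ} {g : ℂ → ℂ}
    (hhull : hull W u = K ∩ upperHalfPlaneSet) (hmap : EqOn (map W u) g (upperHalfPlaneSet \ K)) :
    deriv (map W u) z = deriv g z := by
  have hdom : z ∈ domain W u :=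
    (mem_domain_iff W u z).2 ⟨hz, lt_swallowingTime_of_four_mul_lt hW hz hu⟩
  have hev : map W u =ᶠ[𝓝 z] g :=
    (hmap.mono (domain_subset_diff_of_hull_eq hhull)).eventuallyEq_of_mem
      ((isOpen_domain hW u).mem_nhds hdom)
  exact hev.deriv_eq

/-- **Rohde–Schramm's ratio read off the hull**: `ψ_u(z) = Im z · |g'(z)| / Im g(z)` under the
same hypotheses. [cite: RohdeSchramm2005, Lemma 6.3] -/
theorem derivRatio_eq_of_hull_eq (hW : Continuous W) (hz : 0 < z.im) {u : ℝ≥0}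
    (hu : 4 * (u : ℝ) < z.im ^ 2) {K : Set ℂ} {g : ℂ → ℂ}
    (hhull : hull W u = K ∩ upperHalfPlaneSet) (hmap : EqOn (map W u) g (upperHalfPlaneSet \ K)) :
    derivRatio W z u = z.im * ‖deriv g z‖ / (g z).im := by
  rw [derivRatio, map_eq_of_hull_eq hW hz hu hhull hmap, deriv_map_eq_of_hull_eq hW hz hu hhull hmap]

/-- **The centred flow read off the hull**: `z_u = g(z) - W_u`. [cite: RohdeSchramm2005, Lemma 6.3] -/
theorem centredMap_eq_of_hull_eq (hW : Continuous W) (hz : 0 < z.im) {u : ℝ≥0}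
    (hu : 4 * (u : ℝ) < z.im ^ 2) {K : Set ℂ} {g : ℂ → ℂ}
    (hhull : hull W u = K ∩ upperHalfPlaneSet) (hmap : EqOn (map W u) g (upperHalfPlaneSet \ K)) :
    centredMap W u z = g z - W u := by
  rw [centredMap_apply, map_eq_of_hull_eq hW hz hu hhull hmap]

/-- **Schramm's observable read off the hull**: `S_u(z) = (1 + Re Z/|Z|)/2`, `Z = g(z) - W_u`.
[cite: Schramm2001Percolation, Thm. 2 (proof)] -/
theorem schrammObs_eq_of_hull_eq (hW : Continuous W) (hz : 0 < z.im) {u : ℝ≥0}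
    (hu : 4 * (u : ℝ) < z.im ^ 2) {K : Set ℂ} {g : ℂ → ℂ}
    (hhull : hull W u = K ∩ upperHalfPlaneSet) (hmap : EqOn (map W u) g (upperHalfPlaneSet \ K)) :
    schrammObs W z u = (1 + (g z - W u).re / ‖g z - W u‖) / 2 := by
  rw [schrammObs, centredMap_eq_of_hull_eq hW hz hu hhull hmap]

/-! ### The deterministic time cap: no room stop before `(Im z)²/16` -/

/-- **The level-`m` room stop has not occurred by the cap time.** For a continuous driving
function, `Im z > 0`, a level `m ≥ 1` and a time `u` with `16 u ≤ (Im z)²` and `u ≤ m + 1`: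
`u ≤ inf ({s | Im z_s ≤ Im z/(m+1)} ∪ {m + 1})`. Indeed for `s < u` the point is not swallowed
and `(Im g_s(z))² ≥ (Im z)² - 4s > (3/4)(Im z)² > (Im z/2)² ≥ (Im z/(m+1))²`
(`im_sq_sub_le_im_map_sq`). This is the deterministic localisation ("for all driving terms,
`Im G_t(w) ≥ 2√t` as long as `Im w ≥ 3√t`") that replaces path-dependent stopping on the lattice
side. [cite: CDHKSCRAS2014, §3] -/
theorem le_sInf_roomLevel_of_sixteen_mul_le (hW : Continuous W) (hz : 0 < z.im) {m : ℕ}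
    (hm : 1 ≤ m) {u : ℝ≥0} (hu : 16 * (u : ℝ) ≤ z.im ^ 2) (hum : (u : ℝ) ≤ m + 1) :
    u ≤ sInf ({s : ℝ≥0 | (centredMap W s z).im ≤ z.im / ((m : ℝ) + 1)} ∪ {(m : ℝ≥0) + 1}) := by
  refine le_csInf ⟨(m : ℝ≥0) + 1, Or.inr rfl⟩ ?_
  rintro s (hs | hs)
  · by_contra hlt
    rw [not_le] at hlt
    have hsu : (s : ℝ) < u := NNReal.coe_lt_coe.2 hlt
    have hs4 : 4 * (s : ℝ) < z.im ^ 2 := by nlinarith [s.coe_nonneg]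
    have him := im_sq_sub_le_im_map_sq hW hz hs4
    have hpos : 0 < (map W s z).im :=
      mapsTo_map hW s ((mem_domain_iff W s z).2 ⟨hz, lt_swallowingTime_of_four_mul_lt hW hz hs4⟩)
    have hmem : (centredMap W s z).im ≤ z.im / ((m : ℝ) + 1) := hs
    rw [im_centredMap] at hmem
    have hm1 : z.im / ((m : ℝ) + 1) ≤ z.im / 2 := by
      apply div_le_div_of_nonneg_left hz.le (by norm_num)
      have : (1 : ℝ) ≤ m := by exact_mod_cast hm
      linarith
    have h1 : (map W s z).im ≤ z.im / 2 := hmem.trans hm1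
    have h2 : (map W s z).im ^ 2 ≤ (z.im / 2) ^ 2 := pow_le_pow_left₀ hpos.le h1 2
    nlinarith [s.coe_nonneg]
  · rw [mem_singleton_iff] at hs
    rw [hs, ← NNReal.coe_le_coe]
    push_cast
    exact hum

end Loewner

end Literature.Probability.RandomPlanarGeometry

end
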